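import Literature.NumberTheory.EllipticCurves.ModTwoReducibleIffTwoTorsionRoot
import Summits.BirchSwinnertonDyer.Rank1Residual.X2.ResidualDevissageModules
import HarnessLib

/-!
# Route `TwoAdicConverse` (rung S3), crux `OrdLambdaHalfAtTwo` (item stmt-BirchSwinnertonDyer-19556), line
# `kato-determinant-greenberg-two`: stub 3a `stub_twoTorsionLineOverK` — the rational `2`-torsion point spans a
# `Γ_K`-stable line of `E[2]` over every number field `K`

Lead `cruxlead-stmt-BirchSwinnertonDyer-19556` (skeleton v2 of `Cruxes/OrdLambdaHalfAtTwo/Lines/kato_determinant_greenberg_two.lean`,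
registered 2026-08-28).  The habitat (β) of the line is `¬ W.HasIrreducibleModPGaloisRep 2` for `W/ℚ` (a rational point of
order `2`, tree `not_hasIrreducibleModPGaloisRep_two_iff_exists_isRoot_twoTorsionPolynomial`).  The B2 dévissage of conv-1 GEN 24
(`TwoAdicGreenbergCotorsion.greenbergStrictSelmerDual_finite_torsion_mu_of_residual_cyclotomic_two`) runs along a `Γ_K`-stable
subgroup `Φ ≤ (W.baseChange K)[2]` of order `2` (`X2.ResidualDevissageModules.StableSubgroup`).  This file supplies it:

* `exists_fixed_ne_zero_geomTorsion_two_of_isRoot` — over ANY field `K` of characteristic `0`: a root `x₁ ∈ K` of the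
  `2`-division cubic `4x³ + b₂x² + 2b₄x + b₆` of an elliptic `V/K` gives a NON-ZERO `Γ_K`-FIXED element of
  `V[2] = V(K̄)[2]` (the point `(x₁, −(a₁x₁ + a₃)/2)`; word for word the tree's `ratTwoTorsionCard_ne_one_of_isRoot` over `ℚ`);
* `exists_stableSubgroup_natCard_eq_two_of_isRoot` — its multiples `{O, P}` form a `Γ_K`-stable subgroup of order `2`;
* `isRoot_twoTorsionPolynomial_baseChange` — a rational root stays a root of the cubic of `W.baseChange K`;
* **`stub_twoTorsionLineOverK`** = the registered stub, by name and signature: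
  `∀ W [W.IsElliptic], ¬ W.HasIrreducibleModPGaloisRep 2 → ∀ K [Field K] [NumberField K],
   ∃ Φ : StableSubgroup Γ_K ↥((W.baseChange K).geomTorsion 2), Nat.card Φ.Sub = 2`.

HONEST FRAMING.  Pure bookkeeping (Silverman AEC III.2.3 / Ex. 3.7(b)); closes a supply stub, says nothing about Selmer groups;
BSD is not proved by any of this.  PARTITION (D-0054): none — RANK axis S3 × X5@2 stratum (β).

References: J. H. Silverman, *The Arithmetic of Elliptic Curves*, 2nd ed. (2009), III.2.3, Exercise 3.7(b), VIII.§1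
[SilvermanAEC2009]; J. E. Cremona, *Algorithms for Modular Elliptic Curves* (1997) §3.8 [Cremona1997].
-/

set_option linter.dupNamespace false
set_option autoImplicit false

noncomputable section

open scoped Classical

universe u

namespace Summit.BirchSwinnertonDyer.BirchSwinnertonDyer.Theorems.TwoAdicTwoTorsionLine

open WeierstrassCurve Polynomial Field Literature.NumberTheory.EllipticCurves
  Summit.BirchSwinnertonDyer.Rank1Residual.X2.ResidualDevissageModules

/-! ## §1 Over any field of characteristic zero: a root of the `2`-division cubic gives a fixed point of `E[2]` -/

section AnyField

variable {K : Type u} [Field K] [CharZero K] (V : WeierstrassCurve K) [V.IsElliptic]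

/-- **A root of the `2`-division cubic gives a non-zero `Γ_K`-fixed point of `E[2]`**: for an elliptic `V/K`
(`char K = 0`) and `x₁ ∈ K` with `4x₁³ + b₂x₁² + 2b₄x₁ + b₆ = 0`, the point `P₁ = (x₁, −(a₁x₁ + a₃)/2)` lies on `V`
(`(2y + a₁x + a₃)² − (4x³ + b₂x² + 2b₄x + b₆)` is `4` times the Weierstrass equation), is non-singular (`V` is smooth),
satisfies `P₁ = −P₁`, and its image in `V(K̄)` is a non-zero `Γ_K`-fixed element of `V[2]`.
[cite: SilvermanAEC2009, III.2.3 and Exercise 3.7(b)] -/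
theorem exists_fixed_ne_zero_geomTorsion_two_of_isRoot {x₁ : K} (hx : V.twoTorsionPolynomial.toPoly.IsRoot x₁) :
    ∃ Q : ↥(V.geomTorsion (2 : ℤ)), Q ≠ 0 ∧ ∀ σ : absoluteGaloisGroup K, σ • Q = Q := by
  rw [isRoot_twoTorsionPolynomial_iff] at hx
  set L := AlgebraicClosure K with hL
  set ι := algebraMap K L with hι
  set y₁ : K := -(V.a₁ * x₁ + V.a₃) / 2 with hy₁
  have hψ : 2 * y₁ + V.a₁ * x₁ + V.a₃ = 0 := by
    rw [hy₁, mul_div_cancel₀ _ (two_ne_zero : (2 : K) ≠ 0)]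
    ring
  have heq : V.toAffine.Equation x₁ y₁ := by
    rw [Affine.equation_iff]
    simp only [b₂, b₄, b₆] at hx
    have h4 : (4 : K) * (y₁ ^ 2 + V.a₁ * x₁ * y₁ + V.a₃ * y₁ -
        (x₁ ^ 3 + V.a₂ * x₁ ^ 2 + V.a₄ * x₁ + V.a₆)) = 0 := by
      linear_combination (2 * y₁ + V.a₁ * x₁ + V.a₃) * hψ - hx
    have h4' : (4 : K) ≠ 0 := by norm_num
    exact sub_eq_zero.mp ((mul_eq_zero.mp h4).resolve_left h4')
  have hns : V.toAffine.Nonsingular x₁ y₁ := (Affine.equation_iff_nonsingular).mp heq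
  -- the rational point `P₁ = (x₁, y₁)` and its image `G` in `V(K̄)`
  set P₁ : V.toAffine.Point := .some x₁ y₁ hns with hP₁
  set G : V.geomPoints := toGeomPoints V P₁ with hG
  have eG : ∃ h', G = Affine.Point.some (ι x₁) (ι y₁) h' := ⟨_, rfl⟩
  obtain ⟨h', eG⟩ := eG
  have hneg : ι y₁ = (V.baseChange L).toAffine.negY (ι x₁) (ι y₁) := by
    have e := congrArg ι hψ
    simp only [map_add, map_mul, map_ofNat, map_zero] at e
    rw [Affine.negY, baseChange, map_a₁, map_a₃, ← hι]
    linear_combination e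
  have h2 : G + G = 0 := by
    rw [eG]
    exact Affine.Point.add_self_of_Y_eq hneg
  have hG0 : G ≠ 0 := by
    rw [eG]
    exact Affine.Point.some_ne_zero _
  have hmem : G ∈ geomTorsion V (2 : ℤ) := by
    rw [mem_geomTorsion_iff, two_zsmul, h2]
  have hfix : ∀ σ : absoluteGaloisGroup K, σ • G = G := fun σ ↦ smul_toGeomPoints V σ P₁
  refine ⟨⟨G, hmem⟩, fun h0 ↦ hG0 (congrArg Subtype.val h0), fun σ ↦ Subtype.ext ?_⟩
  rw [AddSubgroup.torsionBy.coe_smul]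
  exact hfix σ

/-- **The multiples `{O, P}` of a non-zero fixed point of `E[2]` form a `Γ_K`-stable subgroup of order `2`.**
Hence a root of the `2`-division cubic in `K` yields `Φ : StableSubgroup Γ_K E[2]` with `#Φ = 2`
(stability: `σ(kP) = k(σP) = kP`; order: `addOrderOf P = 2`). [cite: SilvermanAEC2009, III.2.3 and Exercise 3.7(b)]
[cite: Cremona1997, §3.8] -/
theorem exists_stableSubgroup_natCard_eq_two_of_isRoot {x₁ : K}
    (hx : V.twoTorsionPolynomial.toPoly.IsRoot x₁) :
    ∃ Φ : StableSubgroup (absoluteGaloisGroup K) ↥(V.geomTorsion (2 : ℤ)), Nat.card Φ.Sub = 2 := by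
  obtain ⟨Q, hQ0, hQ⟩ := exists_fixed_ne_zero_geomTorsion_two_of_isRoot V hx
  refine ⟨⟨AddSubgroup.zmultiples Q, fun σ P hP ↦ ?_⟩, ?_⟩
  · obtain ⟨k, rfl⟩ := AddSubgroup.mem_zmultiples_iff.mp hP
    rw [show σ • (k • Q) = k • (σ • Q) from
      map_zsmul (DistribSMul.toAddMonoidHom (↥(geomTorsion V 2)) σ) k Q, hQ]
    exact AddSubgroup.zsmul_mem_zmultiples Q k
  · have h2Q : (2 : ℕ) • Q = 0 := by
      apply Subtype.ext
      have h := (mem_geomTorsion_iff V 2 _).mp Q.2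
      rw [AddSubgroup.coe_nsmul, AddSubgroup.coe_zero, ← natCast_zsmul]
      exact_mod_cast h
    have hord : addOrderOf Q = 2 := (addOrderOf_eq_prime_iff).mpr ⟨h2Q, hQ0⟩
    show Nat.card ↥(AddSubgroup.zmultiples Q) = 2
    rw [Nat.card_zmultiples, hord]

end AnyField

/-! ## §2 The registered stub: from `W/ℚ` with a rational `2`-torsion point to every number field `K` -/

/-- A rational root of the `2`-division cubic of `W/ℚ` is a root of the cubic of `W.baseChange K`
(`b₂, b₄, b₆` are polynomial in the `aᵢ`, so they commute with `algebraMap ℚ K`). [folklore] -/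
theorem isRoot_twoTorsionPolynomial_baseChange (W : WeierstrassCurve ℚ) (K : Type u) [Field K] [CharZero K]
    {x₀ : ℚ} (hx : W.twoTorsionPolynomial.toPoly.IsRoot x₀) :
    (W.baseChange K).twoTorsionPolynomial.toPoly.IsRoot (algebraMap ℚ K x₀) := by
  rw [isRoot_twoTorsionPolynomial_iff] at hx ⊢
  have e : 4 * (algebraMap ℚ K x₀) ^ 3 + (W.baseChange K).b₂ * (algebraMap ℚ K x₀) ^ 2 +
        2 * (W.baseChange K).b₄ * (algebraMap ℚ K x₀) + (W.baseChange K).b₆ =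
      algebraMap ℚ K (4 * x₀ ^ 3 + W.b₂ * x₀ ^ 2 + 2 * W.b₄ * x₀ + W.b₆) := by
    simp only [baseChange, map_b₂, map_b₄, map_b₆, map_add, map_mul, map_pow, map_ofNat]
  rw [e, hx, map_zero]

/-- **stub 3a `stub_twoTorsionLineOverK` of line `kato-determinant-greenberg-two` (crux `OrdLambdaHalfAtTwo`), by name and
signature.**  If `E[2]` is a reducible `Γ_ℚ`-module (a rational point of order `2`), then over every number field `K` the
`Γ_K`-module `(W.baseChange K)[2]` has a `Γ_K`-stable subgroup of order `2` (the line `{O, P}` of the rational `2`-torsion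
point `P`). [cite: SilvermanAEC2009, III.2.3 and Exercise 3.7(b); VIII.§1] [cite: Cremona1997, §3.8] -/
theorem stub_twoTorsionLineOverK :
    ∀ (W : WeierstrassCurve ℚ) [W.IsElliptic], ¬ W.HasIrreducibleModPGaloisRep 2 →
      ∀ (K : Type) [Field K] [NumberField K],
        ∃ Φ : StableSubgroup (absoluteGaloisGroup K) ↥((W.baseChange K).geomTorsion (2 : ℤ)),
          Nat.card Φ.Sub = 2 := by
  intro W _ hβ K _ _
  obtain ⟨x₀, hx₀⟩ := (W.not_hasIrreducibleModPGaloisRep_two_iff_exists_isRoot_twoTorsionPolynomial).mp hβ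
  exact exists_stableSubgroup_natCard_eq_two_of_isRoot (W.baseChange K)
    (isRoot_twoTorsionPolynomial_baseChange W K hx₀)

end Summit.BirchSwinnertonDyer.BirchSwinnertonDyer.Theorems.TwoAdicTwoTorsionLine

end
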